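import Summits.PneNP.PneNP.Theses.KarlinRubin
import Summits.PneNP.PneNP.Theorems.KarlinRubinMonotoneSufficesStubNullMass
import Summits.PneNP.PneNP.Theorems.KarlinRubinMonotoneSufficesStubPlantedMass
import Summits.PneNP.PneNP.Theorems.KarlinRubinMonotoneSufficesStubGglrs

/-!
# Crux `MonotoneSuffices` (stmt-PneNP-18026), line `Sketch` (compression) — monotone FUNCTIONS
suffice, and the line's kernel is EQUIVALENT to the crux

Two consequences of the landed stubs of line `Sketch` (Kleitman down-up compression
`S_e f (x) = (f x[e←0] ∧ f x[e←1]) ∨ (x_e ∧ (f x[e←0] ∨ f x[e←1]))` along an edge coordinate `e`;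
`stub_nullMass`: type I preserved exactly, `stub_plantedMass`: type II never increases, `stub_gglrs`: a
full pass is monotone):

* `monotone_function_suffices` — for EVERY test `f` on the edge vectors of `Kₙ` and every clique size
  `k` there is a MONOTONE Boolean function (the full compression of `f`) whose error sum (type I under
  `G(n,1/2)` + type II under the planted `k`-clique) is at most that of `f`. This is the
  information-theoretic shadow of the crux for every test, not only for the likelihood-ratio test
  (which is monotone by Neyman–Pearson / Karlin–Rubin).
* `compressionBudget_iff_monotoneSuffices` — the line's load-bearing kernel `stub_budget`
  ("for every small strongly detecting `B₂` family there are full coordinate enumerations `l n` and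
  `{∧₂,∨₂,0,1}`-circuits of size `≤ (|C n| + n)^a` agreeing with the `(l n)`-compression of `(C n).eval`
  off a set of vanishing null-plus-planted mass") is EQUIVALENT to the crux `MonotoneSuffices`. The
  direction kernel `→` crux is the skeleton's composition (`errSum(M) ≤ errSum(f⋆) + disagreement ≤
  errSum(C) + o(1)`); the direction crux `→` kernel, overlooked by the idea cards (which call the kernel
  "strictly stronger"), is that ANY two strong detectors are automatically close in pair-measure:
  `μ₀{M ≠ f⋆} + μ₁{M ≠ f⋆} ≤ errSum(M) + errSum(f⋆)` (`disagree_le_errSum_add`), and `errSum(f⋆) ≤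
  errSum(C) → 0`. So line `Sketch` REFORMULATES the crux (canonical witness, negation-structure ladder —
  rung 1 landed as `stub_negatedInputs`) but does not reduce it: its only open stub is the crux itself.
-/

set_option linter.dupNamespace false -- `Summit.PneNP.PneNP.…`: summit = sub-problem name (D-0017)

namespace Summit.PneNP.PneNP.Theorems.MonotoneSuffices.Compression

open Literature.Computability.Complexity Literature.Probability.RandomGraphs.PlantedClique Filter Finset
open Function (update)
open scoped ENNReal
open Summit.PneNP.PneNP.Theses.KarlinRubin (MonotoneSuffices)

/-! ### Compression along a list never increases the error sum -/

/-- Iterated compression along a list of edge coordinates does not increase the error sum (type I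
under `G(n,1/2)` + type II under the planted `k`-clique), by `stub_nullMass` and `stub_plantedMass`.
[folklore] -/
theorem errSum_foldr_compress_le (n k : ℕ) (l : List ((⊤ : SimpleGraph (Fin n)).edgeSet))
    (f : EdgeVec n → Bool) :
    (erdosRenyiHalf n).toOuterMeasure
          {x | l.foldr (fun e g x => (g (update x e false) && g (update x e true)) ||
            (x e && (g (update x e false) || g (update x e true)))) f x = true} +
        (plantedCliqueDist n k).toOuterMeasure
          {x | l.foldr (fun e g x => (g (update x e false) && g (update x e true)) ||
            (x e && (g (update x e false) || g (update x e true)))) f x = false} ≤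
      (erdosRenyiHalf n).toOuterMeasure {x | f x = true} +
        (plantedCliqueDist n k).toOuterMeasure {x | f x = false} := by
  induction l with
  | nil => exact le_rfl
  | cons e l ih =>
    refine le_trans ?_ ih
    rw [List.foldr_cons]
    exact add_le_add (le_of_eq (stub_nullMass n e _)) (stub_plantedMass n k e _)

/-- **Monotone FUNCTIONS suffice on the planted pair.** For every test `f : EdgeVec n → Bool` and every
clique size `k` there is a monotone Boolean function `g` (for the edge-inclusion order) whose type-I error
under `G(n,1/2)` plus type-II error under the planted `k`-clique is at most that of `f`: the full
Kleitman compression of `f` (`stub_gglrs` for monotonicity, `errSum_foldr_compress_le` for the error).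
[folklore] -/
theorem monotone_function_suffices :
    ∀ (n k : ℕ) (f : EdgeVec n → Bool), ∃ g : EdgeVec n → Bool, Monotone g ∧
      (erdosRenyiHalf n).toOuterMeasure {x | g x = true} +
          (plantedCliqueDist n k).toOuterMeasure {x | g x = false} ≤
        (erdosRenyiHalf n).toOuterMeasure {x | f x = true} +
          (plantedCliqueDist n k).toOuterMeasure {x | f x = false} := fun n k f =>
  ⟨(univ : Finset ((⊤ : SimpleGraph (Fin n)).edgeSet)).toList.foldr
      (fun e g x => (g (update x e false) && g (update x e true)) ||
        (x e && (g (update x e false) || g (update x e true)))) f,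
    stub_gglrs n _ f fun e => Finset.mem_toList.2 (mem_univ e), errSum_foldr_compress_le n k _ f⟩

/-! ### Two tests are close in pair-measure when both have small error sum -/

/-- The null-plus-planted mass of the disagreement set of two tests is at most the sum of their error
sums: under the null law `{g ≠ h} ⊆ {g = 1} ∪ {h = 1}`, under the planted law
`{g ≠ h} ⊆ {g = 0} ∪ {h = 0}`. [folklore] -/
theorem disagree_le_errSum_add (n k : ℕ) (g h : EdgeVec n → Bool) :
    (erdosRenyiHalf n).toOuterMeasure {x | g x ≠ h x} +
        (plantedCliqueDist n k).toOuterMeasure {x | g x ≠ h x} ≤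
      ((erdosRenyiHalf n).toOuterMeasure {x | g x = true} +
          (plantedCliqueDist n k).toOuterMeasure {x | g x = false}) +
        ((erdosRenyiHalf n).toOuterMeasure {x | h x = true} +
          (plantedCliqueDist n k).toOuterMeasure {x | h x = false}) := by
  have h0 : (erdosRenyiHalf n).toOuterMeasure {x | g x ≠ h x} ≤
      (erdosRenyiHalf n).toOuterMeasure {x | g x = true} + (erdosRenyiHalf n).toOuterMeasure {x | h x = true} :=
    calc (erdosRenyiHalf n).toOuterMeasure {x | g x ≠ h x}
        ≤ (erdosRenyiHalf n).toOuterMeasure ({x | g x = true} ∪ {x | h x = true}) := by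
          refine MeasureTheory.measure_mono fun x hx => ?_
          simp only [Set.mem_setOf_eq, Set.mem_union, ne_eq] at hx ⊢
          cases hg : g x <;> cases hh : h x <;> simp_all
      _ ≤ _ := MeasureTheory.measure_union_le _ _
  have h1 : (plantedCliqueDist n k).toOuterMeasure {x | g x ≠ h x} ≤
      (plantedCliqueDist n k).toOuterMeasure {x | g x = false} +
        (plantedCliqueDist n k).toOuterMeasure {x | h x = false} :=
    calc (plantedCliqueDist n k).toOuterMeasure {x | g x ≠ h x}
        ≤ (plantedCliqueDist n k).toOuterMeasure ({x | g x = false} ∪ {x | h x = false}) := by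
          refine MeasureTheory.measure_mono fun x hx => ?_
          simp only [Set.mem_setOf_eq, Set.mem_union, ne_eq] at hx ⊢
          cases hg : g x <;> cases hh : h x <;> simp_all
      _ ≤ _ := MeasureTheory.measure_union_le _ _
  calc _ ≤ ((erdosRenyiHalf n).toOuterMeasure {x | g x = true} + (erdosRenyiHalf n).toOuterMeasure {x | h x = true}) +
        ((plantedCliqueDist n k).toOuterMeasure {x | g x = false} +
          (plantedCliqueDist n k).toOuterMeasure {x | h x = false}) := add_le_add h0 h1
    _ = _ := by ring

/-- Conversely, the error sum of a test is at most that of a reference test plus the null-plus-planted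
mass of their disagreement set. [folklore] -/
theorem errSum_le_add_disagree (n k : ℕ) (g h : EdgeVec n → Bool) :
    (erdosRenyiHalf n).toOuterMeasure {x | g x = true} +
        (plantedCliqueDist n k).toOuterMeasure {x | g x = false} ≤
      ((erdosRenyiHalf n).toOuterMeasure {x | h x = true} +
          (plantedCliqueDist n k).toOuterMeasure {x | h x = false}) +
        ((erdosRenyiHalf n).toOuterMeasure {x | g x ≠ h x} +
          (plantedCliqueDist n k).toOuterMeasure {x | g x ≠ h x}) := by
  have h0 : (erdosRenyiHalf n).toOuterMeasure {x | g x = true} ≤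
      (erdosRenyiHalf n).toOuterMeasure {x | h x = true} + (erdosRenyiHalf n).toOuterMeasure {x | g x ≠ h x} :=
    calc (erdosRenyiHalf n).toOuterMeasure {x | g x = true}
        ≤ (erdosRenyiHalf n).toOuterMeasure ({x | h x = true} ∪ {x | g x ≠ h x}) := by
          refine MeasureTheory.measure_mono fun x hx => ?_
          simp only [Set.mem_setOf_eq, Set.mem_union, ne_eq] at hx ⊢
          cases hh : h x <;> simp_all
      _ ≤ _ := MeasureTheory.measure_union_le _ _
  have h1 : (plantedCliqueDist n k).toOuterMeasure {x | g x = false} ≤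
      (plantedCliqueDist n k).toOuterMeasure {x | h x = false} +
        (plantedCliqueDist n k).toOuterMeasure {x | g x ≠ h x} :=
    calc (plantedCliqueDist n k).toOuterMeasure {x | g x = false}
        ≤ (plantedCliqueDist n k).toOuterMeasure ({x | h x = false} ∪ {x | g x ≠ h x}) := by
          refine MeasureTheory.measure_mono fun x hx => ?_
          simp only [Set.mem_setOf_eq, Set.mem_union, ne_eq] at hx ⊢
          cases hh : h x <;> simp_all
      _ ≤ _ := MeasureTheory.measure_union_le _ _
  calc _ ≤ ((erdosRenyiHalf n).toOuterMeasure {x | h x = true} + (erdosRenyiHalf n).toOuterMeasure {x | g x ≠ h x}) +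
        ((plantedCliqueDist n k).toOuterMeasure {x | h x = false} +
          (plantedCliqueDist n k).toOuterMeasure {x | g x ≠ h x}) := add_le_add h0 h1
    _ = _ := by ring

/-! ### The kernel of line `Sketch` is the crux -/

/-- **`CompressionBudget ↔ MonotoneSuffices`.** The load-bearing kernel `stub_budget` of line `Sketch`
(stated verbatim as registered on stmt-PneNP-18026) is equivalent to the crux. `→`: the skeleton's
composition — given a budget `s` and a `B₂` detector `C` of size `≤ s n`, the kernel's monotone circuits
`M n` have size `≤ (|C n| + n)^a ≤ (s n + n)^a` and `errSum(M n) ≤ errSum(f⋆ₙ) + disagreement ≤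
errSum(C n) + o(1) → 0` (`errSum_le_add_disagree`, `errSum_foldr_compress_le`). `←`: apply the crux
with the budget `s n := |C n|` to get monotone strong detectors `M n` of size `≤ (|C n| + n)^a`; take
ANY full enumerations `l n`; then `μ₀{M ≠ f⋆} + μ₁{M ≠ f⋆} ≤ errSum(M n) + errSum(f⋆ₙ) ≤ errSum(M n) +
errSum(C n) → 0` (`disagree_le_errSum_add`). Consequence for the crux chain: line `Sketch` does not
reduce the crux; its open stub is crux-equivalent. [folklore] -/
theorem compressionBudget_iff_monotoneSuffices :
    (∀ δ : ℝ, 0 < δ → δ < 1 / 2 → ∃ a : ℕ,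
      ∀ C : (n : ℕ) → Circuit ((⊤ : SimpleGraph (Fin n)).edgeSet),
        (∀ᶠ n : ℕ in atTop, (C n).IsOver B2) →
        Tendsto (fun n : ℕ =>
            (erdosRenyiHalf n).toOuterMeasure {x | (C n).eval x = true} +
              (plantedCliqueDist n ⌈(n : ℝ) ^ (1 / 2 - δ)⌉₊).toOuterMeasure {x | (C n).eval x = false})
          atTop (nhds 0) →
        ∃ (l : (n : ℕ) → List ((⊤ : SimpleGraph (Fin n)).edgeSet))
          (M : (n : ℕ) → Circuit ((⊤ : SimpleGraph (Fin n)).edgeSet)),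
          (∀ n e, e ∈ l n) ∧
          (∀ᶠ n : ℕ in atTop, (M n).IsOver monotoneBasis01 ∧ (M n).size ≤ ((C n).size + n) ^ a) ∧
          Tendsto (fun n : ℕ =>
              (erdosRenyiHalf n).toOuterMeasure
                  {x | (M n).eval x ≠ (l n).foldr (fun e g x => (g (update x e false) && g (update x e true)) ||
                    (x e && (g (update x e false) || g (update x e true)))) (C n).eval x} +
                (plantedCliqueDist n ⌈(n : ℝ) ^ (1 / 2 - δ)⌉₊).toOuterMeasure
                  {x | (M n).eval x ≠ (l n).foldr (fun e g x => (g (update x e false) && g (update x e true)) ||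
                    (x e && (g (update x e false) || g (update x e true)))) (C n).eval x})
            atTop (nhds 0)) ↔
    MonotoneSuffices := by
  constructor
  · -- kernel → crux (the skeleton's composition)
    intro hB δ hδ hδ'
    obtain ⟨a, ha⟩ := hB δ hδ hδ'
    refine ⟨a, fun s hyp => ?_⟩
    obtain ⟨C, hC, hCerr⟩ := hyp
    obtain ⟨l, M, _hl, hM, hD⟩ := ha C (hC.mono fun n h => h.1) hCerr
    refine ⟨M, ?_, ?_⟩
    · filter_upwards [hM, hC] with n hMn hCn
      exact ⟨hMn.1, hMn.2.trans (Nat.pow_le_pow_left (Nat.add_le_add_right hCn.2 n) a)⟩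
    · have hbound := fun n : ℕ =>
        (errSum_le_add_disagree n ⌈(n : ℝ) ^ (1 / 2 - δ)⌉₊ (M n).eval
          ((l n).foldr (fun e g x => (g (update x e false) && g (update x e true)) ||
            (x e && (g (update x e false) || g (update x e true)))) (C n).eval)).trans
          (add_le_add (errSum_foldr_compress_le n _ (l n) (C n).eval) le_rfl)
      have hsum := hCerr.add hD
      rw [add_zero] at hsum
      exact tendsto_of_tendsto_of_tendsto_of_le_of_le tendsto_const_nhds hsum (fun _ => bot_le) hbound
  · -- crux → kernel: any two strong detectors are close in pair-measure
    intro hMS δ hδ hδ'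
    obtain ⟨a, ha⟩ := hMS δ hδ hδ'
    refine ⟨a, fun C hC hCerr => ?_⟩
    obtain ⟨M, hM, hMerr⟩ := ha (fun n => (C n).size) ⟨C, hC.mono fun n h => ⟨h, le_rfl⟩, hCerr⟩
    refine ⟨fun n => (univ : Finset ((⊤ : SimpleGraph (Fin n)).edgeSet)).toList, M,
      fun n e => Finset.mem_toList.2 (mem_univ e), hM, ?_⟩
    have hbound := fun n : ℕ =>
      (disagree_le_errSum_add n ⌈(n : ℝ) ^ (1 / 2 - δ)⌉₊ (M n).eval
        ((univ : Finset ((⊤ : SimpleGraph (Fin n)).edgeSet)).toList.foldr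
          (fun e g x => (g (update x e false) && g (update x e true)) ||
            (x e && (g (update x e false) || g (update x e true)))) (C n).eval)).trans
        (add_le_add le_rfl (errSum_foldr_compress_le n _ _ (C n).eval))
    have hsum := hMerr.add hCerr
    rw [add_zero] at hsum
    exact tendsto_of_tendsto_of_tendsto_of_le_of_le tendsto_const_nhds hsum (fun _ => bot_le) hbound

end Summit.PneNP.PneNP.Theorems.MonotoneSuffices.Compression
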